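import Literature.MathematicalPhysics.QuantumFieldTheory.Balaban1983to89.B14RegularSpaces234

/-!
# `Balaban1983to89.B14RegularSpaces234Inner` — T. Bałaban, *Convergent renormalization expansions for lattice gauge
theories*, Commun. Math. Phys. **119** (1988) 243–285 [Balaban1988Convergent]: the multi-scale spaces `Ũ^c_j(X, α̃₀, α̃₁)` of p. 261,
(2.34)–(2.39) (sibling `B14RegularSpaces234`) — at the INNERMOST layer `n = j` the conditions (i)–(iii) reduce to the single-scale
conditions (I.1.11)–(I.1.14) of [I] (`B12RegularSpaces111.SatisfiesI_III`) with `(α₀, α₁, γ₀) = (α_{0,j}, α_{1,j}, α_{0,j})`, PROVED; and the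
unit pair as a non-vacuity witness of the space, PROVED

HONEST FRAMING (cell `lit-balaban`, verbatim): statement-level skeleton of published theorems with citation tags; proofs where landed; nothing here is a claim about the Yang–Mills mass gap.

PDF held: `paper:balaban1988-cmp119-convergent-renormalization` (journal page = PDF page + 242); read from the page renders
`b2b-balaban-ref1/pages/1988-cmp119-convergent-renormalization/…-p019-x2.png` (p. 261), as an image; [I] = [Balaban1987RG1] p. 262 from
`…/1987-cmp109-rg-I-small-field/…-p014-x2.png`.

WHAT IS REPRODUCED.  The provable members of SKELETON row `B14.Def@261` over the CONCRETE predicates of `B14RegularSpaces234`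
(`CondI234`, `CondII238`, `CondIII239`, `Satisfies234`, `space234`).  THE PRINT, verbatim (p. 261, after (2.39)): *«The number β is a
small positive constant, but not too small, e.g., we can take β = 1/4. … This definition gives a more detailed and precise form, suitable
for our inductive constructions, of the regularity conditions for background fields, introduced in [13–15].»*; (2.34)–(2.39) read at
`n = j`: the factor `1 − β(1 − 2^{−(j−n)})` is `1` (`B14Radii.shrink_zero`) and `Lⁿξ = Lʲξ = 1` (`ξ = L^{−j}`), so that (2.34) is
`|∂U − 1|, |∂𝐔 − 1| < α_{0,j}ξ²` = (I.1.11)/(I.1.14), (2.36) is `|𝐉| < α_{0,j}` = (I.1.14) with `γ₀ = α₀` ([I] p. 263), (2.38) is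
`|A|, |∇^ξA| < BCMα_{0,j}` = (I.1.12) with `O(1)LMB = BCM`, (2.39) is `|A′|, |∇^ξ_U A′| < α_{1,j}` = (I.1.13).
PROVED: `rad234_inner`, `rad236_inner`, `rad239_inner` (the three radii at `n = j`), **`satisfiesI_III_inner`** (a pair satisfying
(i)–(iii) of p. 261 satisfies (i)–(iii) of [I] on the innermost frame `innerFrame` = `(X∩Ω_j, the cubes «□ ⊂ Ω_j of the size CM»)`, same
factorisation `𝐔 = (exp iξA′)U`; hypotheses `j ≥ 1`, `Lʲξ = 1`, the layer-`j` bonds lie in `X`), `rad234_pos` … `rad237_pos`,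
**`unitPair_mem_space234`** (the unit pair `(1, 0)` of `B12RegularSpaces111Mono` lies in `Ũ^c_j(X, α̃₀, α̃₁)` for `0 ≤ β < 1`, positive
`α_{0,n}, α_{1,n}, L, ξ, BCM`, given that the data of (i) send `1` to unit / zero configurations).  NOT here: the converse embedding of the
single-scale spaces, anything about (2.35)/(2.37) beyond the data hypotheses.  No `Prop` placeholder, no new fact; axioms standard.
Unit `lit-balaban-p07` (Phase-2 seat p07 gen 3), HOME `run/shared/lean/pub/lit-balaban/`.
-/

namespace Literature.MathematicalPhysics.QuantumFieldTheory.Balaban1983to89.B14RegularSpaces234Inner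

open Literature.MathematicalPhysics.QuantumFieldTheory.Balaban1983to89
open Literature.MathematicalPhysics.QuantumFieldTheory.Balaban1983to89.B12RegularSpaces111
open Literature.MathematicalPhysics.QuantumFieldTheory.Balaban1983to89.B14Radii
open Literature.MathematicalPhysics.QuantumFieldTheory.Balaban1983to89.B14RegularSpaces234
open Complex

noncomputable section

variable {P : Params} {i : ℕ} {𝔸 : Type*} [NormedRing 𝔸] [NormedAlgebra ℂ 𝔸] [CompleteSpace 𝔸]
variable {𝓜 : Model 𝔸}

/-! ## §1. The innermost layer `n = j`: reduction to the single-scale conditions (I.1.11)–(I.1.14) -/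

/-- The single-scale frame of [I] read off the innermost layer of a multi-scale frame: `X := X∩Ω_j`, cubes := the cubes «□ ⊂ Ω_j and of
the size CM» of (ii); the (iv)-data of [I] are free parameters (conditions (i)–(iii) of [I] do not use them).
[cite: Balaban1988Convergent, (2.34)-(2.39) p.261] -/
def innerFrame (F : MSFrame P i 𝔸) (j : ℕ) (X₂ : Region P i) (bg : BackgroundFns P i 𝔸) : Frame P i 𝔸 where
  X := F.layer j
  cubes := F.cubes j
  X₂ := X₂
  bg := bg

/-- At the innermost layer the factor is `1` and, for `Lʲξ = 1`, the radius of (2.34) is `α_{0,j}ξ²` — the radius of (I.1.11)/(I.1.14).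
[cite: Balaban1988Convergent, (2.34) p.261] -/
theorem rad234_inner {β a ξ L : ℝ} {j : ℕ} (hLξ : L ^ j * ξ = 1) : rad234 β a ξ L j j = a * ξ ^ 2 := by
  simp [rad234, hLξ]

/-- … the radius of (2.36) is `α_{0,j}` — the `γ₀ = α₀` of (I.1.14). [cite: Balaban1988Convergent, (2.36) p.261] -/
theorem rad236_inner {β a ξ L : ℝ} {j : ℕ} (hLξ : L ^ j * ξ = 1) : rad236 β a ξ L j j = a := by
  simp [rad236, hLξ]

/-- … and the radius of (2.39) is `α_{1,j}` — the `α₁` of (I.1.13). [cite: Balaban1988Convergent, (2.39) p.261] -/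
theorem rad239_inner (β a : ℝ) (j : ℕ) : rad239 β a j j = a := by
  simp [rad239]

/-- **«A more detailed and precise form … of the regularity conditions for background fields, introduced in [13–15]»**: restricted to the
innermost layer `n = j` (`Lʲξ = 1`, `j ≥ 1`, the layer-`j` bonds lying in `X`), a pair satisfying (i)–(iii) of p. 261 satisfies the
single-scale conditions (i)–(iii) of [I], (I.1.11)–(I.1.14) = `B12RegularSpaces111.SatisfiesI_III`, on the frame `(X∩Ω_j, cubes of size CM)`
with the constants `(α₀, α₁, γ₀) = (α_{0,j}, α_{1,j}, α_{0,j})`, `O(1)LMB = BCM`, and the SAME factorisation `𝐔 = (exp iξA′)U`.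
[cite: Balaban1988Convergent, (2.34)-(2.39) p.261] -/
theorem satisfiesI_III_inner {F : MSFrame P i 𝔸} {c : MSConsts} (hj : 1 ≤ c.j) (hLξ : c.L ^ c.j * c.ξ = 1)
    (hsub : (F.layer c.j).bonds ⊆ F.X.bonds) {α₀ α₁ : ℕ → ℝ} {Φ : FieldPair P i 𝔸ˣ 𝔸} (h : Satisfies234 𝓜 F c α₀ α₁ Φ)
    (X₂ : Region P i) (bg : BackgroundFns P i 𝔸) :
    SatisfiesI_III 𝓜 (innerFrame F c.j X₂ bg) c.toStepConsts (α₀ c.j) (α₁ c.j) (α₀ c.j) Φ := by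
  obtain ⟨hG, hg, U, A', hf, h1, h2, h3⟩ := h
  have e34 : rad234 c.β (α₀ c.j) c.ξ c.L c.j c.j = α₀ c.j * c.toStepConsts.ξ ^ 2 := rad234_inner hLξ
  have e36 : rad236 c.β (α₀ c.j) c.ξ c.L c.j c.j = α₀ c.j := rad236_inner hLξ
  have e39 : rad239 c.β (α₁ c.j) c.j c.j = α₁ c.j := rad239_inner _ _ _
  refine ⟨fun b hb => hG b (hsub hb), fun b hb => hg b (hsub hb), U, A', hf, ?_, ?_, ?_⟩
  · -- (i) of [I]: (I.1.11) from (2.34) at `n = j`, (I.1.12) from (2.38) at `n = j`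
    refine ⟨fun b hb => h1.gValued b (hsub hb), fun p hp => e34 ▸ h1.plaq_lt c.j hj le_rfl p hp, fun C hC => ?_⟩
    obtain ⟨u, hu, A, hgauge, hA, hdA⟩ := h2.localGauge c.j hj le_rfl C hC
    refine ⟨u, hu, A, hgauge, fun b hb => ?_, fun q hq => ?_⟩
    · have := hA b hb
      rw [hLξ, one_mul] at this
      exact this
    · have := hdA q hq
      rw [hLξ, one_pow, one_mul] at this
      exact this
  · -- (ii) of [I] = (I.1.13) from (2.39) at `n = j`
    refine ⟨fun b hb => h3.gcValued b (hsub hb), fun b hb => ?_, fun q hq => ?_⟩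
    · have := h3.norm_lt c.j hj le_rfl b hb
      rw [hLξ, one_mul, e39] at this
      exact this
    · have := h3.nabla_lt c.j hj le_rfl q hq
      rw [hLξ, one_pow, one_mul, e39] at this
      exact this
  · -- (iii) of [I] = (I.1.14) from (2.34) for `𝐔` and (2.36) at `n = j`
    exact ⟨fun p hp => e34 ▸ h1.plaqU_lt c.j hj le_rfl p hp, fun b hb => e36 ▸ h1.J_lt c.j hj le_rfl b hb⟩

/-! ## §2. Non-vacuity: the unit pair -/

/-- The radius of (2.34) is positive for `0 ≤ β < 1`, `α_{0,n} > 0`, `L, ξ > 0`. [cite: Balaban1988Convergent, (2.34) p.261] -/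
theorem rad234_pos {β a ξ L : ℝ} {j n : ℕ} (h0 : 0 ≤ β) (h1 : β < 1) (ha : 0 < a) (hL : 0 < L) (hξ : 0 < ξ) :
    0 < rad234 β a ξ L j n := by
  unfold rad234
  exact mul_pos (mul_pos (mul_pos (shrink_pos h0 h1 _) ha) (by positivity)) (zpow_pos (by positivity) _)

/-- The radius of (2.35) is positive likewise. [cite: Balaban1988Convergent, (2.35) p.261] -/
theorem rad235_pos {β a L : ℝ} {j n p : ℕ} (h0 : 0 ≤ β) (h1 : β < 1) (ha : 0 < a) (hL : 0 < L) :
    0 < rad235 β a L j n p := by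
  unfold rad235
  exact mul_pos (mul_pos (mul_pos (shrink_pos h0 h1 _) ha) (zpow_pos hL _))
    (zpow_pos (mul_pos (by positivity) (zpow_pos hL _)) _)

/-- The radius of (2.36) is positive likewise. [cite: Balaban1988Convergent, (2.36) p.261] -/
theorem rad236_pos {β a ξ L : ℝ} {j n : ℕ} (h0 : 0 ≤ β) (h1 : β < 1) (ha : 0 < a) (hL : 0 < L) (hξ : 0 < ξ) :
    0 < rad236 β a ξ L j n := by
  unfold rad236
  exact mul_pos (mul_pos (shrink_pos h0 h1 _) ha) (zpow_pos (by positivity) _)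

/-- The radius of (2.37) is positive likewise. [cite: Balaban1988Convergent, (2.37) p.261] -/
theorem rad237_pos {β a L : ℝ} {j n p : ℕ} (h0 : 0 ≤ β) (h1 : β < 1) (ha : 0 < a) (hL : 0 < L) :
    0 < rad237 β a L j n p := by
  unfold rad237
  exact mul_pos (mul_pos (mul_pos (shrink_pos h0 h1 _) ha) (zpow_pos hL _))
    (zpow_pos (mul_pos (by positivity) (zpow_pos hL _)) _)

/-- **Non-vacuity of (i)–(iii)**: the unit pair `(𝐔, 𝐉) = (1, 0)` (`B12RegularSpaces111Mono.unitPair`) lies in `Ũ^c_j(X, α̃₀, α̃₁)` for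
`0 ≤ β < 1`, positive `α_{0,n}`, `α_{1,n}`, `L, ξ, BCM > 0`, AS SOON AS the data of (i) send the unit configuration to unit / zero
configurations (`U_{p,X}(M˙(1)) = 1`, `𝐉_{p,X}(M˙(1)) = 0` — in print a property of the constructions of [15] and (2.10)–(2.16); here, where
those constructions are data, a hypothesis): factorisation `U = 1`, `A′ = 0`, local gauges `u = 1`, `A = 0`; every printed strict bound holds
with left side `0`. [cite: Balaban1988Convergent, (2.34)-(2.39) p.261] -/
theorem unitPair_mem_space234 (F : MSFrame P i 𝔸) {c : MSConsts} (h0 : 0 ≤ c.β) (h1 : c.β < 1) (hL : 0 < c.L)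
    (hξ : 0 < c.ξ) (hBCM : 0 < c.B * c.C * c.M) {α₀ α₁ : ℕ → ℝ} (hα₀ : ∀ n, 0 < α₀ n) (hα₁ : ∀ n, 0 < α₁ n)
    (hUp : ∀ p, F.bg.Up p 1 = 1) (hJp : ∀ p b, F.bg.Jp p 1 b = 0) :
    (B12RegularSpaces111Mono.unitPair : FieldPair P i 𝔸ˣ 𝔸) ∈ space234 𝓜 F c α₀ α₁ := by
  have h38 : ∀ n, 0 < rad238 c.B c.C c.M (α₀ n) := fun n => mul_pos hBCM (hα₀ n)
  have h39 : ∀ n, 0 < rad239 c.β (α₁ n) c.j n := fun n => mul_pos (shrink_pos h0 h1 _) (hα₁ n)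
  have hplaq : ∀ {k : ℕ} (q : Plaq P k), ‖(↑(plaq (1 : PBond P k → 𝔸ˣ) q) : 𝔸) - 1‖ = 0 := fun q => by
    rw [B12RegularSpaces111Mono.plaq_one, Units.val_one, sub_self, norm_zero]
  refine ⟨fun _ _ => 𝓜.Gc.one_mem, fun _ _ => 𝓜.gc.zero_mem, 1, fun _ => 0,
    B12RegularSpaces111Mono.factors_one c.toStepConsts, ?_, ?_, ?_⟩
  · refine ⟨fun _ _ => 𝓜.G.one_mem, fun n _ _ q _ => ?_, fun n _ _ q _ => ?_, fun p _ _ n _ _ q _ => ?_,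
      fun n _ _ b _ => ?_, fun p _ _ n _ _ b _ => ?_⟩
    · rw [hplaq]; exact rad234_pos h0 h1 (hα₀ n) hL hξ
    · show ‖(↑(plaq (1 : PBond P i → 𝔸ˣ) q) : 𝔸) - 1‖ < _
      rw [hplaq]; exact rad234_pos h0 h1 (hα₀ n) hL hξ
    · show ‖(↑(plaq (F.bg.Up p 1) q) : 𝔸) - 1‖ < _
      rw [hUp, hplaq]; exact rad235_pos h0 h1 (hα₀ n) hL
    · show ‖(0 : 𝔸)‖ < _
      rw [norm_zero]; exact rad236_pos h0 h1 (hα₀ n) hL hξ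
    · show ‖F.bg.Jp p 1 b‖ < _
      rw [hJp, norm_zero]; exact rad237_pos h0 h1 (hα₀ n) hL
  · refine ⟨fun n _ _ C _ => ⟨1, fun _ => 𝓜.G.one_mem, fun _ => 0, fun b _ => ?_, fun b _ => ?_, fun q _ => ?_⟩⟩
    · rw [B12RegularSpaces111Mono.expI_zero]
      show (1 : Site P i → 𝔸ˣ) b.src * (1 : PBond P i → 𝔸ˣ) b * ((1 : Site P i → 𝔸ˣ) b.tgt)⁻¹ = 1
      simp
    · rw [norm_zero, mul_zero]; exact h38 n
    · simp only [grad, sub_self, smul_zero, norm_zero, mul_zero]; exact h38 n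
  · refine ⟨fun _ _ => 𝓜.gc.zero_mem, fun n _ _ b _ => ?_, fun n _ _ q _ => ?_⟩
    · rw [norm_zero, mul_zero]; exact h39 n
    · simp only [nabla, mul_zero, zero_mul, sub_self, smul_zero, norm_zero, mul_zero]; exact h39 n


end

end Literature.MathematicalPhysics.QuantumFieldTheory.Balaban1983to89.B14RegularSpaces234Inner
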